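import Mathlib
import HarnessLib
import Literature.NumberTheory.LFunctions.KMVMomentAsymptoticsBeyondDiagonal
import Summits.Parity.GeneralizedHardyLittlewood.Theses.PrimeLevelFamEdge

/-!
# BC3 birth skeleton — crux `PrimeLevelFamEdge.MomentsBeyondDiagonal` (famE-02, EXISTENCE)

Two registered stubs: the FIRST-moment asymptotic on a window beyond the diagonal (printed
technology — Petersson + Weil — reaches length `q̂^{Δ}` for `Δ < 2`; stated with a free main-term
correction `T₁`) and the SECOND-moment asymptotic with an explicit off-diagonal main term `T₂`
(the open heart: Kloosterman/Kuznetsov analysis at an individual prime level). The crux follows by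
intersecting the two windows (kernel-checked `MomentsBeyondDiagonal_of`).
-/

open Polynomial

namespace Summit.Parity.GeneralizedHardyLittlewood.Theses.PrimeLevelFamEdge

open Literature.NumberTheory.LFunctions

-- (post-birth v2: the crux `MomentsBeyondDiagonal` is now the ROUTE DECL imported from the Theses file; the local copy of the birth draft is removed.)

/-- FIRST-moment asymptotics on the window `(1, Δ]` with main-term functional `lin + T₁`. -/
def FirstMomentBeyond (Δ : ℝ) (T₁ : ℝ → ℝ[X] → ℝ[X] → ℝ) : Prop :=
  ∀ P Q : ℝ[X], KMV2000.Admissible P → KMV2000.IsEvenOrOdd Q → ∀ Δ' : ℝ, 1 < Δ' → Δ' ≤ Δ →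
    ∃ C : ℝ, ∃ q₀ : ℕ, ∀ (q : ℕ) [NeZero q], q.Prime → q₀ ≤ q →
      (∀ n : ℕ, (n : ℝ) ≠ KMV2000.qhat q ^ Δ') →
        ‖KMV2000.LhPQ q P Q (KMV2000.qhat q ^ Δ') -
            ((riemannZeta 2 * ((Real.sqrt (KMV2000.qhat q) / (Δ' * Real.log (KMV2000.qhat q)) : ℝ) : ℂ)) *
              ((KMV2000.linForm Δ' P Q + T₁ Δ' P Q : ℝ) : ℂ))‖ ≤
          C * Real.sqrt (KMV2000.qhat q) * (Real.log (KMV2000.qhat q))⁻¹ ^ 2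

/-- SECOND-moment asymptotics on the window `(1, Δ]` with main-term functional `second + T₂`. -/
def SecondMomentBeyond (Δ : ℝ) (T₂ : ℝ → ℝ[X] → ℝ[X] → ℝ) : Prop :=
  ∀ P Q : ℝ[X], KMV2000.Admissible P → KMV2000.IsEvenOrOdd Q → ∀ Δ' : ℝ, 1 < Δ' → Δ' ≤ Δ →
    ∃ C : ℝ, ∃ q₀ : ℕ, ∀ (q : ℕ) [NeZero q], q.Prime → q₀ ≤ q →
      (∀ n : ℕ, (n : ℝ) ≠ KMV2000.qhat q ^ Δ') →
        ‖KMV2000.QhPQ q P Q (KMV2000.qhat q ^ Δ') -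
            ((2 * riemannZeta 2 ^ 2 *
                ((KMV2000.qhat q / (Δ' ^ 2 * Real.log (KMV2000.qhat q) ^ 2) : ℝ) : ℂ)) *
              ((KMV2000.secondMomentForm Δ' P Q + T₂ Δ' P Q : ℝ) : ℂ))‖ ≤
          C * KMV2000.qhat q * (Real.log (KMV2000.qhat q))⁻¹ ^ 3

/-- stub (M/L): the mollified FIRST harmonic moment at prime level has an asymptotic of the printed
shape on some window beyond the diagonal (expected with `T₁ = 0` up to length `2`: Petersson's
formula, Weil's bound for Kloosterman sums and the approximate functional equation; KMV Prop. 4.1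
prints `Δ < 1` only because nothing more was needed there). -/
theorem stub_firstMomentBeyond :
    ∃ Δ : ℝ, 1 < Δ ∧ ∃ T₁ : ℝ → ℝ[X] → ℝ[X] → ℝ, FirstMomentBeyond Δ T₁ := by
  sorry

/-- stub (XL, the heart): the mollified SECOND harmonic moment at prime level has an asymptotic with a
LEVEL-INDEPENDENT off-diagonal main term `T₂` on some window beyond the diagonal (Kuznetsov on
`Γ₀(q)`, shifted convolutions of the mollifier coefficients against `λ_f`; open in print at an
individual level — Iwaniec–Sarnak have it on average over levels, KMV p. 28 under GRH). -/
theorem stub_secondMomentBeyond :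
    ∃ Δ : ℝ, 1 < Δ ∧ ∃ T₂ : ℝ → ℝ[X] → ℝ[X] → ℝ, SecondMomentBeyond Δ T₂ := by
  sorry

/-- `8 ≤ √q` for `q ≥ 64`, hence `1 ≤ q̂`. -/
private theorem one_le_qhat {q : ℕ} (hq : 64 ≤ q) : 1 ≤ KMV2000.qhat q := by
  have hq64 : (64 : ℝ) ≤ q := by exact_mod_cast hq
  have hsq : (8 : ℝ) ≤ Real.sqrt q := by
    rw [show (8 : ℝ) = Real.sqrt 64 by
      rw [show (64 : ℝ) = 8 ^ 2 by norm_num, Real.sqrt_sq (by norm_num)]]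
    exact Real.sqrt_le_sqrt hq64
  have hπ : 0 < 2 * Real.pi := by positivity
  unfold KMV2000.qhat
  rw [le_div_iff₀ hπ]
  linarith [Real.pi_lt_four]

/-- **Composition (kernel-checked): the two stubs give the crux** — intersect the windows and take
the larger constants. -/
theorem MomentsBeyondDiagonal_of_stubs :
    (∃ Δ : ℝ, 1 < Δ ∧ ∃ T₁ : ℝ → ℝ[X] → ℝ[X] → ℝ, FirstMomentBeyond Δ T₁) →
    (∃ Δ : ℝ, 1 < Δ ∧ ∃ T₂ : ℝ → ℝ[X] → ℝ[X] → ℝ, SecondMomentBeyond Δ T₂) →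
      MomentsBeyondDiagonal := by
  rintro ⟨Δ₁, h₁, T₁, H₁⟩ ⟨Δ₂, h₂, T₂, H₂⟩
  refine ⟨min Δ₁ Δ₂, lt_min h₁ h₂, T₁, T₂, ?_⟩
  intro P Q hP hQ Δ hlo hhi
  obtain ⟨C₁, q₁, HH₁⟩ := H₁ P Q hP hQ Δ hlo (hhi.trans (min_le_left _ _))
  obtain ⟨C₂, q₂, HH₂⟩ := H₂ P Q hP hQ Δ hlo (hhi.trans (min_le_right _ _))
  refine ⟨max C₁ C₂, max (max q₁ q₂) 64, fun q _ hq hq₀ hM ↦ ⟨?_, ?_⟩⟩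
  · have h := HH₁ q hq (le_trans (le_max_left _ _) (le_trans (le_max_left _ _) hq₀)) hM
    exact h.trans (mul_le_mul_of_nonneg_right
      (mul_le_mul_of_nonneg_right (le_max_left _ _) (Real.sqrt_nonneg _)) (sq_nonneg _))
  · have h := HH₂ q hq (le_trans (le_max_right _ _) (le_trans (le_max_left _ _) hq₀)) hM
    have hq1 : 1 ≤ KMV2000.qhat q := one_le_qhat (le_trans (le_max_right _ _) hq₀)
    have hq' : 0 ≤ KMV2000.qhat q := zero_le_one.trans hq1
    have hlog : 0 ≤ (Real.log (KMV2000.qhat q))⁻¹ := inv_nonneg.mpr (Real.log_nonneg hq1)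
    exact h.trans (mul_le_mul_of_nonneg_right
      (mul_le_mul_of_nonneg_right (le_max_right _ _) hq') (pow_nonneg hlog 3))

/-- BC3 composition in REGISTERED shape: the ROUTE crux `MomentsBeyondDiagonal` from the two named stubs (the only
sorries of this file live inside `stub_*`). -/
theorem MomentsBeyondDiagonal_of : MomentsBeyondDiagonal :=
  MomentsBeyondDiagonal_of_stubs stub_firstMomentBeyond stub_secondMomentBeyond

end Summit.Parity.GeneralizedHardyLittlewood.Theses.PrimeLevelFamEdge
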